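import Mathlib
import HarnessLib
import HarnessLib.Audit
import Summits.AtomisticToContinuum.Statement
import Literature.MathematicalPhysics.KineticTheory.HarmonicChainFlux
import Summits.AtomisticToContinuum.FouriersLaw.Theorems.EmbeddedDrudeMourreNessUnique
import Summits.AtomisticToContinuum.FouriersLaw.Theorems.FourierGreenKuboFourierFiniteResponseOfUnique

/-!
Route: OnsetOfResistance

CLOSED (retired) 2026-08-15T13:45:20Z by operator:999:1257524 — reason: not-a-thesis: assembly does not conclude the sub-problem Statement — note: D-0027 §2.1 audit (human 2026-08-15: routes that do not decide the summit are removed): the assembly concludes `Literature.MathematicalPhysics.KineticTheory.HeatConduction.FouriersLaw`, not the sub-problem statement; a NEW conforming route may be opened from the same idea (generated `closes : … → _r. The file is kept as the record of this route; refuted decls are indexed as negative knowledge (`ledger negatives`).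

# Route OnsetOfResistance — onset of resistance — N²-secular second order of the RLL response,
kinetic finite-size scaling of the resistance, Fourier's law at low temperature

Realises card onset-of-resistance-secular-series (spine). Work with the conjunct's own finite-N
response D_N(T) of
pinnedChain ω₂ lam β γ (all four > 0; canonical under weak-NESS uniqueness) and the resistance
R_N(T) := (N−1)/D_N(T).
By the PROVED conjugacy D_N(T; lam, β) = D_N(1; lamT, βT) (LowTemperatureWeakAnharmonicity) low
temperature is weak
anharmonicity around the PROVED Rieder–Lebowitz–Lieb/Nakazawa point D_N = (N−1)·fluxCoeff ω₂ γ N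
(HarmonicChainFlux).
It suffices to show X = X_onset ∧ X_window ∧ X_exch ∧ X_high ∧ X_bridge ∧ X_uniq:
X_onset (SecularOnset): D_N(T) = (N−1)c_N + d₁(N)T + d₂(N)T² + o(T²) at T → 0⁺ with d₂(N)/N² → −s <
0 — one power of N
more than ballistic: the first rigorous sign of resistance in a deterministic-bulk chain
(Lefevere–Schenkel's first order is
N-uniform); X_window (KineticWindowResistance): along the kinetic window N = ⌈x/T²⌉ the resistance
has a scaling limit
ρ(x) = lim_{T→0⁺} R_N(T) with ρ(x)/x → r ∈ (0,∞) (Fourier's law in the window, κ ≍ T⁻²); X_exch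
(WindowToLowTFourier):
the window law implies BLR's clause (ii) pointwise on an initial temperature interval (0,T₀); X_high
(HighTFourier, shared
verbatim with route ScaleFreeQuarticAnchor) and X_bridge (BridgeClosure: low ∧ high ⇒ every T, the
residual compact middle
of the effective-coupling axis); X_uniq = NessUnique (stmt-0741, shared).
Lean: `SecularOnset ∧ KineticWindowResistance ∧ WindowToLowTFourier ∧ HighTFourier ∧ BridgeClosure ∧
NessUnique`

## Assembly
Bookkeeping only, verified rc 0 by the planner (Sketch.lean `assembly_proof`, axioms propext /
Classical.choice /
Quot.sound): clause (i) of FouriersLawFor from the PROVED existence theorem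
Literature.MathematicalPhysics.KineticTheory.HeatConduction.pinnedChain_exists_isSteadyState (CEHR
2018 Thm 2.13, all N) + NessUnique;
clause (ii): KineticWindowResistance discharges the hypothesis of WindowToLowTFourier (∃ T₀,
pointwise Fourier on (0,T₀)),
HighTFourier gives the tail, BridgeClosure gives every T > 0; κ T := Classical.choose of the
pointwise statement (κ := 1 off
(0,∞)); conclude with Literature.HeatConduction.fouriersLaw_of_steadyState_and_linearResponse.
SecularOnset is carried as
the first antecedent and is NOT used by the glue: it is the x → 0⁺ germ of the window law (matching
ρ(0⁺) = 1/c_∞,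
ρ′(0⁺) = s/c_∞², informal item KineticMatching), the route's first theorem-sized deliverable and its
cheapest falsifier.
Provers: import Literature.MathematicalPhysics.KineticTheory.LangevinChainNESSHolds and
Summits.AtomisticToContinuum.FouriersLaw.Theorems.FourierGreenKuboAssembly besides the route file.

Rationale: WHY THIS LINE. Expand the BATHED finite chain's response in the effective anharmonicity (lamT, βT)
around the explicitly solved
Gaussian steady state (RiederLebowitzLieb1967, Nakazawa1970, RoyDhar2008 §2 (2.8); in tree:
chainCov, fluxCoeff_eq,
tendsto_fluxCoeff, harmonicNESS, all proved): LefevereSchenkel2004 §6 computed the first order and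
found the current
correction N-uniform ("perturbative analysis does not, at first order, reveal any sign that Fourier
law holds"; "one might
expect the derivatives of the heat current to develop a singularity at λ = 0 when N → ∞"), and
Spohn2006PhononBoltzmann §17
and Kupiainen (book:arous2008 p.35: "if λ² is too small compared with 1/N the system behaves as the
harmonic one") named the
window N ≍ λ⁻² without computing anything. The line makes the onset quantitative: at SECOND order
the correction is secular,
d₂ ≍ −sN² (a resolvent double pole: a band phonon lives ≍ N/v before a bath absorbs it and is
scattered at rate ≍ sλ²
meanwhile; a planner's slab first-collision computation gives s = ¼⟨φ_γ,(−C_lin)φ_γ⟩ > 0 with φ_γ =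
θ_γ(k)·sign ω′(k) the
contact-filtered RLL occupation profile and C_lin the linearised 4-phonon operator of
AokiLukkarinenSpohn2006 §3 — so s
DEPENDS on γ, correcting the card's Claim 2), then resums it on the kinetic scale N ≍ T⁻² where the
open geometry turns the
hopeless post-kinetic tail of Green–Kubo into an ESCAPE problem with finite horizon (thermostatted
kinetic limits:
KomorowskiOlla2020, KomorowskiEtAl2020, BasileOllaSpohn2009; lattice kinetic limits
LukkarinenSpohn2010, VassilevWu2026;
slab transport / Milne layers BardosSantosSentis1984, BensoussanLionsPapanicolaou1979). Imported
areas: finite-dimensional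
hypoelliptic perturbation theory (HairerMajda2009, CuneoEckmannHairerReyBellet2018), wave-kinetic
Feynman-diagram
expansions, linear transport in slabs. What it does that no open route does:
FourierGreenKubo/DrudeMourre work in infinite
volume at fixed coupling; FeketeResistance/SuperadditiveJunction/BathRenormalisation are structural
at fixed T; this is the
only line that computes the N-DEPENDENCE of BLR's own D_N in a controlled corner, and it feeds
SuperadditiveJunction's
finite-size certificate (B) exactly where certified numerics cannot reach (N₀ ≍ T⁻²). Negatives
index: empty at filing.

RANKED CRUXES. #2 SecularOnset (crux) — card Claim 1 (ONSET OF RESISTANCE). For pinnedChain ω₂ lam β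
γ (all > 0), under weak-NESS uniqueness, for every steady-state family and every response function D
(D N T = lim_{δ→0,δ≠0} totalCurrent(μ N (T+δ/2) (T−δ/2))/δ for all T > 0, N): there are d₁, d₂ : ℕ →
ℝ and s > 0 with, for every N ≥ 2, D N T = (N−1)·fluxCoeff ω₂ γ N + d₁(N)·T + d₂(N)·T² + o(T²) as T
→ 0⁺ (second-order expansion at the harmonic point; by the proved conjugacy this is the expansion of
D_N(1; lamT, βT) in the couplings), and d₂(N)/N² → −s. Engine: second-order Dyson/Duhamel expansion
of the hypoelliptic OU semigroup of the open harmonic chain (driftMatrix, lyapSol in tree) in the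
cubic force, Wick calculus in chainCov, then large-N asymptotics of a golden-rule mode sum whose
regulator is the escape rate ≍ γ/N; expected s = ¼⟨φ_γ,(−C_lin)φ_γ⟩ (informal item KineticMatching).
[difficulty: L] (why it might fail: The fixed-N expansion in T at 0⁺ may not exist (quartic force
unbounded w.r.t. the OU reference; LS2004 postponed regularity); d₂ could scale like N²log N
(band-edge phonons v→0, folds of the resonance curve) since the golden-rule regulator γ/N equals the
level spacing.) [LefevereSchenkel2004, Spohn2006PhononBoltzmann, AokiLukkarinenSpohn2006,
VassilevWu2026, RoyDhar2008, HairerMajda2009, CuneoEckmannHairerReyBellet2018, decl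
Literature.MathematicalPhysics.KineticTheory.HeatConduction.fluxCoeff_eq]
#3 KineticWindowResistance (crux) — card Claim 4 (KINETIC FINITE-SIZE SCALING), stated on D_N alone.
Under weak-NESS uniqueness, for every steady-state family and response function D of pinnedChain ω₂
lam β γ (all > 0) there are ρ : ℝ → ℝ and r > 0 such that for every x > 0 the resistance along the
window N = ⌈x/T²⌉ converges, (N−1)/D N T → ρ(x) as T → 0⁺, and ρ(x)/x → r as x → ∞ (asymptotically
Ohmic: Fourier's law inside the kinetic window with κ(T) ≈ 1/(rT²), the ALS (λT)⁻² law in BLR's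
geometry). Expected structure (not asserted): ρ = 1/Γ with Γ the two-wall conductance of the
stationary linearised phonon-Boltzmann slab with end-thermostat albedo (card
kinetic-slab-with-contacts), ρ(0⁺) = 1/fluxLimit ω₂ γ, ρ′(0⁺) = s/fluxLimit² (matching with
SecularOnset), ρ(x) − x r → finite contact resistance. [deps: SecularOnset] [difficulty:
open-problem] (why it might fail: Needs a STATIONARY boundary-driven anharmonic kinetic limit at
full kinetic time (t≍N≍T_kin): the best theorem stops at t≤T_kin^(2/3) at equilibrium with random
phases (VassilevWu2026 Thm 1.1); Gibbs data, open ends, phonon-number quasi-conservation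
(HuveneersLukkarinen2020) are uncontrolled.) [AokiLukkarinenSpohn2006, Spohn2006PhononBoltzmann,
VassilevWu2026, LukkarinenSpohn2010, KomorowskiOlla2020, KomorowskiEtAl2020, BasileOllaSpohn2009,
BardosSantosSentis1984, BensoussanLionsPapanicolaou1979, HuveneersLukkarinen2020,
book:arous2008-stochastic-analysis-mathematical-physics-proceedings-satellite-confere p.35]
#4 WindowToLowTFourier (crux) — UNIFORMITY BEYOND THE WINDOW (the card's declared wall, filed as an
implication so that the window law is usable): for pinnedChain ω₂ lam β γ (all > 0), under weak-NESS
uniqueness, IF the window law of KineticWindowResistance holds for every steady-state family and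
response function, THEN there is T₀ > 0 such that for every T ∈ (0,T₀) Fourier's law holds pointwise
at T (∃ k > 0, ∀ steady-state families, ∃ D, response limits exist ∧ D N → k; the inline clause of
route ScaleFreeQuarticAnchor). Foreseen engine (Two-layer plan): the window law supplies, for all
small T, ONE length N₀ = ⌈x/T²⌉ with R_{N₀}(T) > C; a T-uniform superadditive series law R_{N+M} ≥
R_N + R_M − C (SuperadditiveJunction stmt-2191, sharpened to C independent of T ≤ T₀ — expected
since C(T) → ρ_c(γ) at the kinetic level) plus Fekete (stmt-2195) and non-insulation (stmt-2193)
then give D_N(T) → κ(T) ∈ (0,∞): kinetic theory as the generator of the finite-size certificate.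
[deps: KineticWindowResistance] [difficulty: open-problem] (why it might fail: Exchange of limits:
at fixed T, N→∞ leaves the window (N ≫ ℓ₂ ≍ T^(-2p), HuveneersLukkarinen2020); the only bridges are
a T-uniform superadditive series law (no sign principle; SuperadditiveJunction's bet) plus
non-insulation, or N-uniform remainders — none known.) [BonettoLebowitzReyBellet2000,
HuveneersLukkarinen2020, Hammersley1988, decl
Literature.Barriers.AtomisticToContinuum.LowTemperatureWeakAnharmonicity, decl
Literature.Barriers.AtomisticToContinuum.HasBoundedResponse, stmt-AtomisticToContinuum-2191,
stmt-AtomisticToContinuum-2193, stmt-AtomisticToContinuum-2195]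
#5 BridgeClosure (crux) — BRIDGE CLOSURE IN TEMPERATURE (residual; NOT this card's mechanism): for
pinnedChain ω₂ lam β γ (all > 0), if Fourier's law holds pointwise on an initial interval (0,T₀), T₀
> 0, and on a tail (T₁,∞), then it holds pointwise at every T > 0. By the conjugacy this is the
conjunct on the compact middle of the effective-coupling ray {(lamT, βT)}; strictly weaker than
clause (ii) (two hypotheses), weaker than LowTClosure (stmt-3281) and than upward closure; the plug
between this route's low-temperature half and the high-temperature half HighTFourier (stmt-3282) of
route ScaleFreeQuarticAnchor. [difficulty: open-problem] (why it might fail: It is the conjunct on a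
compact interval of effective couplings away from both corners: no connectedness or monotonicity of
the set of Fourier temperatures is known; an intermediate anomalous window (resonance thresholds in
ω₂, near-integrable pockets) would break it.) [AokiLukkarinenSpohn2006, BricmontKupiainen2007,
HuveneersLukkarinen2020, decl
Literature.Barriers.AtomisticToContinuum.LowTemperatureWeakAnharmonicity,
stmt-AtomisticToContinuum-3281, stmt-AtomisticToContinuum-3282]
#9 LowTFourier (support) — LOW-TEMPERATURE FOURIER LAW as a standalone node (the route's regime
deliverable): for pinnedChain ω₂ lam β γ (all > 0) there is T₀ > 0 such that for every T ∈ (0,T₀)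
Fourier's law holds pointwise at T (inline clause). Equals KineticWindowResistance +
WindowToLowTFourier + NessUnique by modus ponens (planner sketch, lowTFourier_of, rc 0); filed so
that any other kinetic-corner method (cards kinetic-corner-deng-hani-post-kinetic-tail,
kinetic-slab-with-contacts, routes DrudeMourre via AbelThermodynamicLimit) can close the
low-temperature half, and so that high-temperature routes can want it. [difficulty: open-problem]
[AokiLukkarinenSpohn2006, BonettoLebowitzReyBellet2000]
#9 HighTFourier (support) — HIGH-TEMPERATURE FOURIER LAW (= stmt-AtomisticToContinuum-3282 of route
ScaleFreeQuarticAnchor, verbatim; there it is AnchorFourier + EtaContinuation): for pinnedChain ω₂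
lam β γ (all > 0) there is T₁ with pointwise Fourier at every T > T₁. Not this card's mechanism;
shared so that the two regime routes meet in BridgeClosure. [difficulty: open-problem]
[stmt-AtomisticToContinuum-3282, AokiLukkarinenSpohn2006]
#9 NessUnique (support) — UNIQUENESS OF THE WEAK STEADY STATE (= stmt-AtomisticToContinuum-0741,
verbatim, shared with FourierGreenKubo / FeketeResistance / ScaleFreeQuarticAnchor): for pinnedChain
ω₂ lam β γ (all > 0), every N and T_L, T_R > 0, any two measures in the class IsSteadyState
coincide. Makes D_N canonical in every item above; with the proved existence theorem
pinnedChain_exists_isSteadyState it is clause (i). [difficulty: L] [CuneoEckmannHairerReyBellet2018,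
Carmona2007]
#9 FiniteResponseOfUnique (support) — FINITE-N LINEAR RESPONSE EXISTS (=
stmt-AtomisticToContinuum-0717, verbatim, shared): under weak-NESS uniqueness the response limits
D_N(T) exist for every T > 0 and N. De-vacuifies the ∀ D quantifier of SecularOnset /
KineticWindowResistance (their response-function hypothesis is then met by D N T := the limit).
[difficulty: L] [ReyBellet2003, HairerMajda2009]
#9 HarmonicLimitOfResponse (support) — ZEROTH ORDER — CONTINUITY OF THE RESPONSE AT THE RLL POINT
(fixed N): under weak-NESS uniqueness, for every steady-state family and response function D of
pinnedChain ω₂ lam β γ (all > 0) and every N, D N T → (N−1)·fluxCoeff ω₂ γ N as T → 0⁺ (N = 0, 1: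
both sides 0). By the conjugacy: the response of the chain with couplings (lamT, βT) at temperature
1 tends to the harmonic response (N−1)c_N (fluxCoeff_eq,
integral_bondCurrent_harmonicNESS_eq_fluxCoeff, proved) as the couplings vanish — stability of the
finite-N NESS and of its temperature-derivative under a vanishing quartic perturbation
(uniform-in-coupling Lyapunov/hypocoercive control at fixed N). The base case of SecularOnset; a
Lean warm-up with real content. [difficulty: M] [LefevereSchenkel2004, RoyDhar2008, HairerMajda2009,
decl
Literature.MathematicalPhysics.KineticTheory.HeatConduction.integral_bondCurrent_harmonicNESS_eq_fluxCoeff]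
#9 FirstOrderBallistic (support) — FIRST ORDER IS STILL BALLISTIC (LefevereSchenkel2004 §6.1 made a
theorem in BLR's linear-response normalisation, with the FPU-β bond quartic included): under
weak-NESS uniqueness, for every steady-state family and response function D there are d₁ : ℕ → ℝ and
c₁ with (D N T − (N−1)·fluxCoeff ω₂ γ N)/T → d₁(N) as T → 0⁺ for every N ≥ 2, and d₁(N)/N → c₁ (a
Hartree renormalisation of the ballistic coefficient: same N-scaling as order zero — "the
first-order correction of the heat current does not depend on the size of the system"). The first
rung of SecularOnset. [difficulty: L] [LefevereSchenkel2004, doi:10.1103/physrevd.101.125002]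

TWO-LAYER PLAN. WindowToLowTFourier ⇐ LowTUniformSuperadditivity → KineticCertificate →
WindowToLowTFourier (k = 2 new children + shared
stmt-2193 ConductanceLowerBound and stmt-2195 SuperadditiveFekete as the glue's real-analysis
inputs): LowTUniformSuperadditivity =
stmt-2191 with the junction constant C independent of T ∈ (0,T₁] (expected: C(T) → ρ_c(γ, ω₂,
β/lam), the kinetic contact
resistance); KineticCertificate = "∀ C ∃ T₂ ∀ T < T₂ ∃ N₀ ≥ 2: (N₀−1)/D_{N₀}(T) > C" (immediate from
KineticWindowResistance:
ρ(x) → ∞). KineticWindowResistance ⇐ KineticSlabLimit → SlabMilneAsymptotics →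
KineticWindowResistance (the two cruxes of
card kinetic-slab-with-contacts, once the linearised phonon-Boltzmann operator is a Literature
object — Definition requests).
SecularOnset ⇐ SecondOrderExpansionExists (fixed N; HarmonicLimitOfResponse / FirstOrderBallistic
are its rungs) →
GoldenRuleModeSum (large-N asymptotics of the explicit second-order coefficient) → SecularOnset.
Nothing here is filed now.

KILL CRITERIA. SecularOnset refuted (d₂(N) ≥ 0 eventually, or |d₂(N)|/N² → 0 or ∞): close
`refuted:SecularOnset` — the whole line
(window law, kinetic matching) rests on the N² onset; hand the data to card
kinetic-slab-with-contacts as a constraint.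
KineticWindowResistance refuted with ρ(x)/x → 0 (sub-Ohmic window) or → ∞: pivot to the
corresponding anomalous window law
(new route); refuted by non-existence of ρ (oscillating R along the window): close.
WindowToLowTFourier refuted (window law
true, low-T Fourier false): ¬FouriersLaw is then in reach — file it. BridgeClosure refuted: an
intermediate anomalous
temperature exists ⇒ ¬FouriersLaw outright. LowTFourier proved elsewhere (DrudeMourre +
AbelThermodynamicLimit, or a
Deng–Hani-type tail bound) moots cruxes 3–4 but not SecularOnset.

NOT DECOMPOSED YET. The fixed-N perturbation theory (existence of the T-expansion:
uniform-in-coupling Lyapunov control of the NESS and of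
its δT-derivative), the golden-rule mode sum (equidistribution of the resonance curve against the
open-chain mode grid of
spacing ≍ 1/N with regulator ≍ γ/N), the identification s = ¼⟨φ_γ,(−C_lin)φ_γ⟩ and r = 1/L_ee
(informal item
KineticMatching; needs the collision operator as a Literature object), the slab boundary-value
problem with end-thermostat
albedo and its Milne asymptotics (card kinetic-slab-with-contacts), the T-uniform junction constant,
the Drude-pole picture
(card Claim 3: radius of analyticity ≍ N^{-1/2}, geometric d_{2k} — conjectural beyond k = 1, not
filed), and the
O(n)-vector 1/n variant uniform in T (card large-n-phonon-lenard-balescu's territory).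

CHEAPEST FALSIFIER. EXACT second-order perturbation theory at small N is finite linear algebra:
around the Gaussian RLL state the perturbative
moment hierarchy CLOSES order by order (order-1 moments of degree ≤ 4 need Gaussian moments of
degree ≤ 6 by Wick in chainCov;
order-2 moments of degree ≤ 2 need order-1 moments of degree ≤ 4; the drift block on each degree is
invertible since the
drift is Hurwitz), and the δT-linearisation is exact because chainCov is linear in (T_L, T_R). Kit
job: for ω₂ = γ = 1,
β/lam ∈ {0, 1}, N = 2…16, solve the sparse systems (dimension C(2N+3,4) ≤ 5·10⁴) and tabulate d₂(N);
fit −sN² + bN + c.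
d₂(N) of one sign growing like N², s > 0, c_N-consistent zeroth order and N-bounded d₁(N)/(N−1) ⇒
the spine survives;
anything else kills SecularOnset today. (Not yet run at filing; the planner records the recipe; a
refuter or the planner's
follow-up kit job executes it.)

NUMBERS. c_N = γ/(2(1+γ²))·(r + r^{2N−2})/(1 + r^{2N−1}), r + 1/r = 2 + ω₂γ²/(1+γ²), c_∞ =
γr/(2(1+γ²)) (fluxCoeff_eq, fluxLimit;
RoyDhar2008 (2.8)). Kinetic conductivity of the φ⁴ chain: lim_{T→0} T²κ = δ^{-3/2}c(δ), c(0) =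
0.2756, δ = 1/(ω₂+2) ∈ (0,½)
(AokiLukkarinenSpohn2006 (3.25)–(3.26), §4); kinetic time T_kin = 1/(4πβ²) and the rigorous reach t
≤ N^{-ε}min(N, N^{4γ/3})
for β = N^{-γ} (VassilevWu2026 (1.12), Thm 1.1) — on our diagonal γ = ½ this is t ≲ T_kin^{2/3} ≪ N;
phonon-number
relaxation ℓ₂ ≍ (λT)^{-2p}, p = 2 for 0.3 < δ < ½ (HuveneersLukkarinen2020 pp. 2–3); numerics κ ∝
T^{-1.35} (φ⁴,
AokiKusnezov2001) vs kinetic T^{-2}. Items at open: 11 (+1 informal KineticMatching, +1 definition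
request).

DEFINITION REQUESTS. (D1) LinearizedPhononBoltzmannOperator (topic
Literature/MathematicalPhysics/KineticTheory): the linearised 4-phonon
collision operator C_lin of the pinned nearest-neighbour chain, ω(k)² = ω₂ + 4sin²(k/2), with vertex
lam·(on-site) +
β·(bond) (AokiLukkarinenSpohn2006 §3 (3.13)–(3.20); Spohn2006PhononBoltzmann; collision invariants
Spohn2006), as a
symmetric operator on L²(𝕋, dk) with its quadratic form — needed to TYPE KineticMatching (s =
¼⟨φ_γ,(−C_lin)φ_γ⟩,
r = 1/L_ee) and the slab children of KineticWindowResistance. (D2, later) the end-thermostat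
reflection coefficient R_γ(k)
of the semi-infinite RLL chain (card kinetic-slab-with-contacts item 1), definable from
driftMatrix/chainCov technology.
Informal statement filed after open: KineticMatching [support] — Claim 2 of the card CORRECTED: s
depends on γ through
φ_γ = ((1−R_γ)/(1+R_γ))·sign ω′; only the large-x slope r is bulk (γ-independent); ρ(0⁺) = 1/c_∞,
ρ′(0⁺) = s/c_∞².

Novelty: Searches (2026-08-15): `lit frontier AtomisticToContinuum --since 2020` (30 rows; relevant:
arXiv:2605.19308 VassilevWu2026
rigorous WKE for β-FPUT up to T_kin^{2/3}, read pp. 1–4; arXiv:2604.14056, arXiv:2606.08839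
bathed-chain numerics);
`lit bridges AtomisticToContinuum --cross any` (30 rows, none on finite-size kinetic scaling); `lit
search --source crossref
"perturbative nonequilibrium steady state anharmonic chain second order heat current system size"`
(12: ReyBelletThomas2000,
Hsiang–Hu doi:10.1103/physrevd.101.125002 and Yang–Hsiang–Jordan–Hu doi:10.1016/j.aop.2020.168289 —
first-order functional
perturbation theory for weakly anharmonic OPEN QUANTUM chains, no N-structure); `lit search --source
crossref "ballistic to
diffusive crossover … anharmonic chain …"` (11: Roy2012 open anharmonic lattices via self-consistent
treatment, Chen 2001
ballistic–diffusive phenomenology); `lit search --hybrid … --source local` (10: Kupiainen's review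
book:arous2008 p.35 naming
the window λ² ≷ 1/N); `lit galaxy search "perturbative analysis of anharmonic chains …" --star all`
and `"ballistic to
diffusive crossover heat conduction anharmonic chain" --star all` (0 hits; first call queued out,
recorded); `lit read
arXiv:math-ph/0303050` pp. 2–4, 11 (first order only, N-uniform, regularity postponed, "one might
expect the derivatives …
to develop a singularity at λ = 0"); the card's own and its novelty audit's searches
(Spohn2006PhononBoltzmann §17 p.34
sentence); all ten route files of  [refs: 10.1103/physrevd.101.125002, 10.1016/j.aop.2020.168289, 10.1023/b:joss.0000028064.17281.bb, 2605.19308, 2604.14056, 2606.08839, math-ph/0303050, doi:10.1103/physrevd.101.125002, doi:10.1016/j.aop.2020.168289, book:arous2008, doi:10.1023/b, VassilevWu2026, Roy2012, LefevereSchenkel2004, KomorowskiOlla2020, KomorowskiEtAl2020]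

Barriers (technique_class: secular-series; kinetic-finite-size-scaling): - technique_class: secular-series; kinetic-finite-size-scaling
- Literature.Barriers.AtomisticToContinuum.LowTemperatureWeakAnharmonicity: APPLIES squarely and is
conceded — no finite-order or T-uniform estimate is asked to bound D_N at fixed couplings:
SecularOnset is a fixed-N expansion whose coefficients are read for their N-GROWTH (the divergence κ
≍ T⁻² is reproduced, κ ≈ 1/(rT²), not fought), KineticWindowResistance is the barrier's own listed
evasion (resummation on the kinetic scale N ≍ (λT)⁻²), and the wall it erects (λ → 0 before N → ∞)
is filed openly as crux WindowToLowTFourier with a non-perturbative engine (series law + Fekete).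
- Literature.Barriers.AtomisticToContinuum.HarmonicChainBallisticFlux: the refuted harmonic member
is the expansion POINT (proved: fluxCoeff_eq, tendsto_fluxCoeff); every item degenerates correctly
there (d₁ = d₂ = 0, ρ ≡ 1/c_∞ would violate ρ(x)/x → r > 0): the route cannot prove too much, its
content is how the next orders destroy ballistic transport.
- Literature.Barriers.AtomisticToContinuum.HasBoundedResponse: not evaded at fixed T by cruxes 2–3
(they bound nothing uniformly in N at fixed coupling); it is met head-on only in
WindowToLowTFourier, whose foreseen engine (T-uniform superadditivity + one kinetic certificate +
non-insulation) is a statement about chains of lengths N, M, N+M, outside the fixed-N class the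
barrier documents.
- Literature.Barriers.AtomisticToContinuum.LukkarinenSpohn2008_lemma41: the FPU kinetic anomaly need

History (route lifecycle, newest last):
- 2026-08-15T13:45:20Z · CLOSED retired — not-a-thesis: assembly does not conclude the sub-problem Statement (operator:999:1257524)

sub-problem: FouriersLaw · status: closed(retired) · opened planner-plancard-AtomisticToContinuum-Fourier-70ad6ee7-0 2026-08-15T11:35:01Z · rev 0 · ledger route-AtomisticToContinuum-OnsetOfResistance
GENERATED by the gate from the ledger (D-0016/17). Provers cite these decls: `theorem foo : Summit.AtomisticToContinuum.FouriersLaw.Theses.OnsetOfResistance.<Decl> := …` in Summits/AtomisticToContinuum/FouriersLaw/Theorems/<Name>.lean.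
-/

namespace Summit.AtomisticToContinuum.FouriersLaw.Theses.OnsetOfResistance

open scoped BigOperators Topology Manifold Classical MeasureTheory ProbabilityTheory Matrix InnerProductSpace ComplexConjugate ContinuousMap
open Filter Set Function TopologicalSpace MeasureTheory

attribute [summit_statement] _root_.FouriersLaw

/-- item stmt-AtomisticToContinuum-4768 · crux · rank 2 · closed · moot by None · by planner
why it might fail: The fixed-N expansion in T at 0⁺ may not exist (quartic force unbounded w.r.t. the OU reference; LS2004 postponed regularity); d₂ could scale like N²log N (band-edge phonons v→0, folds of the resonance curve) since the golden-rule regulator γ/N equals the level spacing.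
sources: LefevereSchenkel2004, Spohn2006PhononBoltzmann, AokiLukkarinenSpohn2006, VassilevWu2026, RoyDhar2008, HairerMajda2009
[crux] card Claim 1 (ONSET OF RESISTANCE). For pinnedChain ω₂ lam β γ (all > 0), under weak-NESS
uniqueness, for every steady-state family and every response function D (D N T = lim_{δ→0,δ≠0}
totalCurrent(μ N (T+δ/2) (T−δ/2))/δ for all T > 0, N): there are d₁, d₂ : ℕ → ℝ and s > 0 with, for
every N ≥ 2, D N T = (N−1)·fluxCoeff ω₂ γ N + d₁(N)·T + d₂(N)·T² + o(T²) as T → 0⁺ (second-order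
expansion at the harmonic point; by the proved conjugacy this is the expansion of D_N(1; lamT, βT)
in the couplings), and d₂(N)/N² → −s. Engine: second-order Dyson/Duhamel expansion of the
hypoelliptic OU semigroup of the open harmonic chain (driftMatrix, lyapSol in tree) in the cubic
force, Wick calculus in chainCov, then large-N asymptotics of a golden-rule mode sum whose regulator
is the escape rate ≍ γ/N; expected s = ¼⟨φ_γ,(−C_lin)φ_γ⟩ (informal item KineticMatching).
[difficulty: L] -/
@[route_item "route-AtomisticToContinuum-OnsetOfResistance"]
def SecularOnset : Prop :=
  ∀ ω₂ lam β γ : ℝ, 0 < ω₂ → 0 < lam → 0 < β → 0 < γ → (∀ (N : ℕ) (T_L T_R : ℝ), 0 < T_L → 0 < T_R → ∀ μ ν : MeasureTheory.Measure (Literature.MathematicalPhysics.KineticTheory.HeatConduction.PhaseSpace N), (Literature.MathematicalPhysics.KineticTheory.HeatConduction.pinnedChain ω₂ lam β γ).IsSteadyState N T_L T_R μ → (Literature.MathematicalPhysics.KineticTheory.HeatConduction.pinnedChain ω₂ lam β γ).IsSteadyState N T_L T_R ν → μ = ν) → ∀ μ : (N : ℕ) → ℝ → ℝ → MeasureTheory.Measure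 (Literature.MathematicalPhysics.KineticTheory.HeatConduction.PhaseSpace N), (∀ (N : ℕ) (T_L T_R : ℝ), 0 < T_L → 0 < T_R → (Literature.MathematicalPhysics.KineticTheory.HeatConduction.pinnedChain ω₂ lam β γ).IsSteadyState N T_L T_R (μ N T_L T_R)) → ∀ D : ℕ → ℝ → ℝ, (∀ T : ℝ, 0 < T → ∀ N : ℕ, Filter.Tendsto (fun δ : ℝ => (Literature.MathematicalPhysics.KineticTheory.HeatConduction.pinnedChain ω₂ lam β γ).totalCurrent (μ N (T + δ / 2) (T - δ / 2)) / δ) (nhdsWithin 0 {(0 : ℝ)}ᶜ) (nhds (D N T))) → ∃ d₁ d₂ : ℕ → ℝ, ∃ s : ℝ, 0 < s ∧ (∀ N : ℕ, 2 ≤ N → Filter.Tendsto (fun T : ℝ => (D N T - ((N - 1 : ℕ) : ℝ) * Literature.MathematicalPhysics.KineticTheory.HeatConduction.fluxCoeff ω₂ γ N - d₁ N * T - d₂ N * T ^ 2) / T ^ 2) (nhdsWithin 0 (Set.Ioi 0)) (nhds 0)) ∧ Filter.Tendsto (fun N : ℕ => d₂ N / (N : ℝ) ^ 2) Filter.atTop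 (nhds (-s))

/-- item stmt-AtomisticToContinuum-4769 · crux · rank 3 · closed · moot by None · by planner
why it might fail: Needs a STATIONARY boundary-driven anharmonic kinetic limit at full kinetic time (t≍N≍T_kin): the best theorem stops at t≤T_kin^(2/3) at equilibrium with random phases (VassilevWu2026 Thm 1.1); Gibbs data, open ends, phonon-number quasi-conservation (HuveneersLukkarinen2020) are uncontrolled.
sources: AokiLukkarinenSpohn2006, Spohn2006PhononBoltzmann, VassilevWu2026, LukkarinenSpohn2010, KomorowskiOlla2020, KomorowskiEtAl2020
[crux] card Claim 4 (KINETIC FINITE-SIZE SCALING), stated on D_N alone. Under weak-NESS uniqueness,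
for every steady-state family and response function D of pinnedChain ω₂ lam β γ (all > 0) there are
ρ : ℝ → ℝ and r > 0 such that for every x > 0 the resistance along the window N = ⌈x/T²⌉ converges,
(N−1)/D N T → ρ(x) as T → 0⁺, and ρ(x)/x → r as x → ∞ (asymptotically Ohmic: Fourier's law inside
the kinetic window with κ(T) ≈ 1/(rT²), the ALS (λT)⁻² law in BLR's geometry). Expected structure
(not asserted): ρ = 1/Γ with Γ the two-wall conductance of the stationary linearised
phonon-Boltzmann slab with end-thermostat albedo (card kinetic-slab-with-contacts), ρ(0⁺) =
1/fluxLimit ω₂ γ, ρ′(0⁺) = s/fluxLimit² (matching with SecularOnset), ρ(x) − x r → finite contact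
resistance. [deps: SecularOnset] [difficulty: open-problem] -/
@[route_item "route-AtomisticToContinuum-OnsetOfResistance"]
def KineticWindowResistance : Prop :=
  ∀ ω₂ lam β γ : ℝ, 0 < ω₂ → 0 < lam → 0 < β → 0 < γ → (∀ (N : ℕ) (T_L T_R : ℝ), 0 < T_L → 0 < T_R → ∀ μ ν : MeasureTheory.Measure (Literature.MathematicalPhysics.KineticTheory.HeatConduction.PhaseSpace N), (Literature.MathematicalPhysics.KineticTheory.HeatConduction.pinnedChain ω₂ lam β γ).IsSteadyState N T_L T_R μ → (Literature.MathematicalPhysics.KineticTheory.HeatConduction.pinnedChain ω₂ lam β γ).IsSteadyState N T_L T_R ν → μ = ν) → ∀ μ : (N : ℕ) → ℝ → ℝ → MeasureTheory.Measure (Literature.MathematicalPhysics.KineticTheory.HeatConduction.PhaseSpace N), (∀ (N : ℕ) (T_L T_R : ℝ), 0 < T_L → 0 < T_R → (Literature.MathematicalPhysics.KineticTheory.HeatConduction.pinnedChain ω₂ lam β γ).IsSteadyState N T_L T_R (μ N T_L T_R)) → ∀ D : ℕ → ℝ → ℝ, (∀ T : ℝ, 0 < T → ∀ N : ℕ, Filter.Tendsto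 (fun δ : ℝ => (Literature.MathematicalPhysics.KineticTheory.HeatConduction.pinnedChain ω₂ lam β γ).totalCurrent (μ N (T + δ / 2) (T - δ / 2)) / δ) (nhdsWithin 0 {(0 : ℝ)}ᶜ) (nhds (D N T))) → ∃ ρ : ℝ → ℝ, ∃ r : ℝ, 0 < r ∧ (∀ x : ℝ, 0 < x → Filter.Tendsto (fun T : ℝ => ((⌈x / T ^ 2⌉₊ - 1 : ℕ) : ℝ) / D ⌈x / T ^ 2⌉₊ T) (nhdsWithin 0 (Set.Ioi 0)) (nhds (ρ x))) ∧ Filter.Tendsto (fun x : ℝ => ρ x / x) Filter.atTop (nhds r)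

/-- item stmt-AtomisticToContinuum-4770 · crux · rank 4 · closed · moot by None · by planner
why it might fail: Exchange of limits: at fixed T, N→∞ leaves the window (N ≫ ℓ₂ ≍ T^(-2p), HuveneersLukkarinen2020); the only bridges are a T-uniform superadditive series law (no sign principle; SuperadditiveJunction's bet) plus non-insulation, or N-uniform remainders — none known.
sources: BonettoLebowitzReyBellet2000, HuveneersLukkarinen2020, Hammersley1988, decl Literature.Barriers.AtomisticToContinuum.LowTemperatureWeakAnharmonicity, decl Literature.Barriers.AtomisticToContinuum.HasBoundedResponse, stmt-AtomisticToContinuum-2191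
[crux] UNIFORMITY BEYOND THE WINDOW (the card's declared wall, filed as an implication so that the
window law is usable): for pinnedChain ω₂ lam β γ (all > 0), under weak-NESS uniqueness, IF the
window law of KineticWindowResistance holds for every steady-state family and response function,
THEN there is T₀ > 0 such that for every T ∈ (0,T₀) Fourier's law holds pointwise at T (∃ k > 0, ∀
steady-state families, ∃ D, response limits exist ∧ D N → k; the inline clause of route
ScaleFreeQuarticAnchor). Foreseen engine (Two-layer plan): the window law supplies, for all small T,
ONE length N₀ = ⌈x/T²⌉ with R_{N₀}(T) > C; a T-uniform superadditive series law R_{N+M} ≥ R_N + R_M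
− C (SuperadditiveJunction stmt-2191, sharpened to C independent of T ≤ T₀ — expected since C(T) →
ρ_c(γ) at the kinetic level) plus Fekete (stmt-2195) and non-insulation (stmt-2193) then give D_N(T)
→ κ(T) ∈ (0,∞): kinetic theory as the generator of the finite-size certificate. [deps:
KineticWindowResistance] [difficulty: open-problem] -/
@[route_item "route-AtomisticToContinuum-OnsetOfResistance"]
def WindowToLowTFourier : Prop :=
  ∀ ω₂ lam β γ : ℝ, 0 < ω₂ → 0 < lam → 0 < β → 0 < γ → (∀ (N : ℕ) (T_L T_R : ℝ), 0 < T_L → 0 < T_R → ∀ μ ν : MeasureTheory.Measure (Literature.MathematicalPhysics.KineticTheory.HeatConduction.PhaseSpace N), (Literature.MathematicalPhysics.KineticTheory.HeatConduction.pinnedChain ω₂ lam β γ).IsSteadyState N T_L T_R μ → (Literature.MathematicalPhysics.KineticTheory.HeatConduction.pinnedChain ω₂ lam β γ).IsSteadyState N T_L T_R ν → μ = ν) → (∀ μ : (N : ℕ) → ℝ → ℝ → MeasureTheory.Measure (Literature.MathematicalPhysics.KineticTheory.HeatConduction.PhaseSpace N), (∀ (N : ℕ) (T_L T_R : ℝ),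 0 < T_L → 0 < T_R → (Literature.MathematicalPhysics.KineticTheory.HeatConduction.pinnedChain ω₂ lam β γ).IsSteadyState N T_L T_R (μ N T_L T_R)) → ∀ D : ℕ → ℝ → ℝ, (∀ T : ℝ, 0 < T → ∀ N : ℕ, Filter.Tendsto (fun δ : ℝ => (Literature.MathematicalPhysics.KineticTheory.HeatConduction.pinnedChain ω₂ lam β γ).totalCurrent (μ N (T + δ / 2) (T - δ / 2)) / δ) (nhdsWithin 0 {(0 : ℝ)}ᶜ) (nhds (D N T))) → ∃ ρ : ℝ → ℝ, ∃ r : ℝ, 0 < r ∧ (∀ x : ℝ, 0 < x → Filter.Tendsto (fun T : ℝ => ((⌈x / T ^ 2⌉₊ - 1 : ℕ) : ℝ) / D ⌈x / T ^ 2⌉₊ T) (nhdsWithin 0 (Set.Ioi 0)) (nhds (ρ x))) ∧ Filter.Tendsto (fun x : ℝ => ρ x / x) Filter.atTop (nhds r)) → ∃ T₀ : ℝ, 0 < T₀ ∧ ∀ T : ℝ, 0 < T → T < T₀ → ∃ k : ℝ, 0 < k ∧ ∀ μ : (N : ℕ) → ℝ → ℝ → MeasureTheory.Measure (Literature.MathematicalPhysics.KineticTheory.HeatConduction.PhaseSpace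 N), (∀ (N : ℕ) (T_L T_R : ℝ), 0 < T_L → 0 < T_R → (Literature.MathematicalPhysics.KineticTheory.HeatConduction.pinnedChain ω₂ lam β γ).IsSteadyState N T_L T_R (μ N T_L T_R)) → ∃ D : ℕ → ℝ, (∀ N : ℕ, Filter.Tendsto (fun δ : ℝ => (Literature.MathematicalPhysics.KineticTheory.HeatConduction.pinnedChain ω₂ lam β γ).totalCurrent (μ N (T + δ / 2) (T - δ / 2)) / δ) (nhdsWithin 0 {(0 : ℝ)}ᶜ) (nhds (D N))) ∧ Filter.Tendsto D Filter.atTop (nhds k)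

/-- item stmt-AtomisticToContinuum-4771 · crux · rank 5 · closed · moot by None · by planner
why it might fail: It is the conjunct on a compact interval of effective couplings away from both corners: no connectedness or monotonicity of the set of Fourier temperatures is known; an intermediate anomalous window (resonance thresholds in ω₂, near-integrable pockets) would break it.
sources: AokiLukkarinenSpohn2006, BricmontKupiainen2007, HuveneersLukkarinen2020, decl Literature.Barriers.AtomisticToContinuum.LowTemperatureWeakAnharmonicity, stmt-AtomisticToContinuum-3281, stmt-AtomisticToContinuum-3282
[crux] BRIDGE CLOSURE IN TEMPERATURE (residual; NOT this card's mechanism): for pinnedChain ω₂ lam β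
γ (all > 0), if Fourier's law holds pointwise on an initial interval (0,T₀), T₀ > 0, and on a tail
(T₁,∞), then it holds pointwise at every T > 0. By the conjugacy this is the conjunct on the compact
middle of the effective-coupling ray {(lamT, βT)}; strictly weaker than clause (ii) (two
hypotheses), weaker than LowTClosure (stmt-3281) and than upward closure; the plug between this
route's low-temperature half and the high-temperature half HighTFourier (stmt-3282) of route
ScaleFreeQuarticAnchor. [difficulty: open-problem] -/
@[route_item "route-AtomisticToContinuum-OnsetOfResistance"]
def BridgeClosure : Prop :=
  ∀ ω₂ lam β γ : ℝ, 0 < ω₂ → 0 < lam → 0 < β → 0 < γ → (∃ T₀ : ℝ, 0 < T₀ ∧ ∀ T : ℝ, 0 < T → T < T₀ → ∃ k : ℝ, 0 < k ∧ ∀ μ : (N : ℕ) → ℝ → ℝ → MeasureTheory.Measure (Literature.MathematicalPhysics.KineticTheory.HeatConduction.PhaseSpace N), (∀ (N : ℕ) (T_L T_R : ℝ), 0 < T_L → 0 < T_R → (Literature.MathematicalPhysics.KineticTheory.HeatConduction.pinnedChain ω₂ lam β γ).IsSteadyState N T_L T_R (μ N T_L T_R)) → ∃ D : ℕ → ℝ,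 (∀ N : ℕ, Filter.Tendsto (fun δ : ℝ => (Literature.MathematicalPhysics.KineticTheory.HeatConduction.pinnedChain ω₂ lam β γ).totalCurrent (μ N (T + δ / 2) (T - δ / 2)) / δ) (nhdsWithin 0 {(0 : ℝ)}ᶜ) (nhds (D N))) ∧ Filter.Tendsto D Filter.atTop (nhds k)) → (∃ T₁ : ℝ, ∀ T : ℝ, T₁ < T → ∃ k : ℝ, 0 < k ∧ ∀ μ : (N : ℕ) → ℝ → ℝ → MeasureTheory.Measure (Literature.MathematicalPhysics.KineticTheory.HeatConduction.PhaseSpace N), (∀ (N : ℕ) (T_L T_R : ℝ), 0 < T_L → 0 < T_R → (Literature.MathematicalPhysics.KineticTheory.HeatConduction.pinnedChain ω₂ lam β γ).IsSteadyState N T_L T_R (μ N T_L T_R)) → ∃ D : ℕ → ℝ, (∀ N : ℕ, Filter.Tendsto (fun δ : ℝ => (Literature.MathematicalPhysics.KineticTheory.HeatConduction.pinnedChain ω₂ lam β γ).totalCurrent (μ N (T + δ / 2) (T - δ / 2)) / δ) (nhdsWithin 0 {(0 : ℝ)}ᶜ) (nhds (D N))) ∧ Filter.Tendsto D Filter.atTop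 (nhds k)) → ∀ T : ℝ, 0 < T → ∃ k : ℝ, 0 < k ∧ ∀ μ : (N : ℕ) → ℝ → ℝ → MeasureTheory.Measure (Literature.MathematicalPhysics.KineticTheory.HeatConduction.PhaseSpace N), (∀ (N : ℕ) (T_L T_R : ℝ), 0 < T_L → 0 < T_R → (Literature.MathematicalPhysics.KineticTheory.HeatConduction.pinnedChain ω₂ lam β γ).IsSteadyState N T_L T_R (μ N T_L T_R)) → ∃ D : ℕ → ℝ, (∀ N : ℕ, Filter.Tendsto (fun δ : ℝ => (Literature.MathematicalPhysics.KineticTheory.HeatConduction.pinnedChain ω₂ lam β γ).totalCurrent (μ N (T + δ / 2) (T - δ / 2)) / δ) (nhdsWithin 0 {(0 : ℝ)}ᶜ) (nhds (D N))) ∧ Filter.Tendsto D Filter.atTop (nhds k)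

/-- item stmt-AtomisticToContinuum-0717 · support · rank 9 · closed · proved by Summit.AtomisticToContinuum.FouriersLaw.Theorems.FourierGreenKubo.finiteResponseOfUnique_holds (prover) · by planner
sources: ReyBellet2003, HairerMajda2009
CONDITIONAL FORM OF 0705 (supersedes it as the prover target; refuters pool-5/g3-0: 0705 stand-alone
quantifies over EVERY steady-state family and is false-prone if weak steady states were non-unique):
assuming UNIQUENESS of weak steady states (IsSteadyState class) for pinnedChain at all N, T_L, T_R >
0, the finite-N linear-response limit D_N(T) = lim_{δ→0, δ≠0} totalCurrent(μ_{N,T+δ/2,T−δ/2})/δ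
exists for every T > 0 and N. Content: differentiability at equilibrium of NESS expectations of the
polynomial currents in the bath temperatures (ReyBellet2003 arXiv:math-ph/0303021 Rem 4.4 (51)–(56)
finite-volume Green–Kubo; HairerMajda2009 arXiv:0909.4313 Thm 2.3 framework — their SDE Thm 4.4
Assumption 5 fails here, so verify Assumptions 1–3 via CEHR2018 (2.5)/Carmona2007 Thm 1.1(iv)
weighted spectral gap). N = 0, 1: totalCurrent ≡ 0, D = 0. Together with 0706 gives 0705. -/
@[route_item "route-AtomisticToContinuum-OnsetOfResistance"]
def FiniteResponseOfUnique : Prop :=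
  ∀ ω₂ lam β γ : ℝ, 0 < ω₂ → 0 < lam → 0 < β → 0 < γ → (∀ (N : ℕ) (T_L T_R : ℝ), 0 < T_L → 0 < T_R → ∀ μ ν : MeasureTheory.Measure (Literature.MathematicalPhysics.KineticTheory.HeatConduction.PhaseSpace N), (Literature.MathematicalPhysics.KineticTheory.HeatConduction.pinnedChain ω₂ lam β γ).IsSteadyState N T_L T_R μ → (Literature.MathematicalPhysics.KineticTheory.HeatConduction.pinnedChain ω₂ lam β γ).IsSteadyState N T_L T_R ν → μ = ν) → ∀ μ : (N : ℕ) → ℝ → ℝ → MeasureTheory.Measure (Literature.MathematicalPhysics.KineticTheory.HeatConduction.PhaseSpace N), (∀ (N : ℕ) (T_L T_R : ℝ), 0 < T_L → 0 < T_R → (Literature.MathematicalPhysics.KineticTheory.HeatConduction.pinnedChain ω₂ lam β γ).IsSteadyState N T_L T_R (μ N T_L T_R)) → ∀ T : ℝ, 0 < T → ∀ N : ℕ, ∃ D : ℝ, Filter.Tendsto (fun δ : ℝ => (Literature.MathematicalPhysics.KineticTheory.HeatConduction.pinnedChain ω₂ lam β γ).totalCurrent (μ N (T + δ / 2) (T -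 δ / 2)) / δ) (nhdsWithin 0 {(0 : ℝ)}ᶜ) (nhds D)

/-- item stmt-AtomisticToContinuum-0741 · support · rank 9 · closed · proved by Summit.AtomisticToContinuum.FouriersLaw.Theorems.nessUnique_proof (prover) · by planner
sources: CuneoEckmannHairerReyBellet2018, Carmona2007
[crux] UNIQUENESS OF THE WEAK STEADY STATE (the half of stmt-0706 not covered by the landed fact
Literature.MathematicalPhysics.KineticTheory.HeatConduction.CuneoEckmannHairerReyBellet2018_pinnedChain,
p3544): for pinnedChain ω₂ lam β γ (all > 0), every N and T_L, T_R > 0, any two measures in the weak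
Fokker–Planck class IsSteadyState (probability, ∫ L f dμ = 0 for f ∈ C_c^∞, bond currents
integrable) coincide. Print: uniqueness of the INVARIANT MEASURE of the Langevin semigroup
(CuneoEckmannHairerReyBellet2018 Thm 2.13(1): C1, C2, CA; Carmona2007 Thm 1.1(iii)); the item
additionally needs 'weak stationary probability solution of L*μ = 0 ⇒ P_t-invariant' for this
hypoelliptic L with cubic drift (Echeverría 1982 well-posed martingale problem on C_c^∞ +
non-explosion via e^{θH}; Bogachev–Krylov–Röckner–Shaposhnikov 2015 Ch. 5 is non-degenerate only) —
the FP-identification lemma is the formal crux. N = 0: PhaseSpace 0 is a point (unique probability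
measure); N = 1: both baths on site 0, OU at temperature (T_L+T_R)/2. This is exactly the hypothesis
of FiniteResponse and ThermodynamicLimit and, with the fact, gives clause (i) of FouriersLawFor. -/
@[route_item "route-AtomisticToContinuum-OnsetOfResistance"]
def NessUnique : Prop :=
  ∀ ω₂ lam β γ : ℝ, 0 < ω₂ → 0 < lam → 0 < β → 0 < γ → ∀ (N : ℕ) (T_L T_R : ℝ), 0 < T_L → 0 < T_R → ∀ μ ν : MeasureTheory.Measure (Literature.MathematicalPhysics.KineticTheory.HeatConduction.PhaseSpace N), (Literature.MathematicalPhysics.KineticTheory.HeatConduction.pinnedChain ω₂ lam β γ).IsSteadyState N T_L T_R μ → (Literature.MathematicalPhysics.KineticTheory.HeatConduction.pinnedChain ω₂ lam β γ).IsSteadyState N T_L T_R ν → μ = ν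

/-- `NessUnique` holds: proved by `Summit.AtomisticToContinuum.FouriersLaw.Theorems.nessUnique_proof`. -/
theorem NessUnique_holds : NessUnique := _root_.Summit.AtomisticToContinuum.FouriersLaw.Theorems.nessUnique_proof

/-- item stmt-AtomisticToContinuum-3282 · support · rank 9 · closed · moot by None · by planner
sources: stmt-AtomisticToContinuum-3282, AokiLukkarinenSpohn2006
[support] HIGH-TEMPERATURE FOURIER LAW, the card's deliverable as a standalone node: for ω₂, lam, β,
γ > 0 there is T₁ such that pinnedChain ω₂ lam β γ obeys Fourier's law pointwise (inline clause) at
every T > T₁. Equals AnchorFourier + EtaContinuation by modus ponens at lam/β (planner proof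
attached, AssemblyProof.lean highT_of_anchor_eta); filed so that any other high-temperature method
(e.g. the porous-medium hydrodynamics of card porous-medium-anchor-barenblatt, or a direct
non-perturbative argument at large (lamT, βT)) can close the high-T half without the anchor. [deps:
AnchorFourier, EtaContinuation] [difficulty: open-problem] -/
@[route_item "route-AtomisticToContinuum-OnsetOfResistance"]
def HighTFourier : Prop :=
  ∀ ω₂ lam β γ : ℝ, 0 < ω₂ → 0 < lam → 0 < β → 0 < γ → ∃ T₁ : ℝ, ∀ T : ℝ, T₁ < T → ∃ k : ℝ, 0 < k ∧ ∀ μ : (N : ℕ) → ℝ → ℝ → MeasureTheory.Measure (Literature.MathematicalPhysics.KineticTheory.HeatConduction.PhaseSpace N), (∀ (N : ℕ) (T_L T_R : ℝ), 0 < T_L → 0 < T_R → (Literature.MathematicalPhysics.KineticTheory.HeatConduction.pinnedChain ω₂ lam β γ).IsSteadyState N T_L T_R (μ N T_L T_R)) → ∃ D : ℕ → ℝ, (∀ N : ℕ, Filter.Tendsto (fun δ : ℝ => (Literature.MathematicalPhysics.KineticTheory.HeatConduction.pinnedChain ω₂ lam β γ).totalCurrent (μ N (T + δ / 2) (T - δ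 / 2)) / δ) (nhdsWithin 0 {(0 : ℝ)}ᶜ) (nhds (D N))) ∧ Filter.Tendsto D Filter.atTop (nhds k)

/-- item stmt-AtomisticToContinuum-4772 · support · rank 9 · closed · moot by None · by planner
sources: AokiLukkarinenSpohn2006, BonettoLebowitzReyBellet2000
[support] LOW-TEMPERATURE FOURIER LAW as a standalone node (the route's regime deliverable): for
pinnedChain ω₂ lam β γ (all > 0) there is T₀ > 0 such that for every T ∈ (0,T₀) Fourier's law holds
pointwise at T (inline clause). Equals KineticWindowResistance + WindowToLowTFourier + NessUnique by
modus ponens (planner sketch, lowTFourier_of, rc 0); filed so that any other kinetic-corner method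
(cards kinetic-corner-deng-hani-post-kinetic-tail, kinetic-slab-with-contacts, routes DrudeMourre
via AbelThermodynamicLimit) can close the low-temperature half, and so that high-temperature routes
can want it. [difficulty: open-problem] -/
@[route_item "route-AtomisticToContinuum-OnsetOfResistance"]
def LowTFourier : Prop :=
  ∀ ω₂ lam β γ : ℝ, 0 < ω₂ → 0 < lam → 0 < β → 0 < γ → ∃ T₀ : ℝ, 0 < T₀ ∧ ∀ T : ℝ, 0 < T → T < T₀ → ∃ k : ℝ, 0 < k ∧ ∀ μ : (N : ℕ) → ℝ → ℝ → MeasureTheory.Measure (Literature.MathematicalPhysics.KineticTheory.HeatConduction.PhaseSpace N), (∀ (N : ℕ) (T_L T_R : ℝ), 0 < T_L → 0 < T_R → (Literature.MathematicalPhysics.KineticTheory.HeatConduction.pinnedChain ω₂ lam β γ).IsSteadyState N T_L T_R (μ N T_L T_R)) → ∃ D : ℕ → ℝ, (∀ N : ℕ, Filter.Tendsto (fun δ : ℝ => (Literature.MathematicalPhysics.KineticTheory.HeatConduction.pinnedChain ω₂ lam β γ).totalCurrent (μ N (T + δ / 2) (T - δ / 2)) / δ) (nhdsWithin 0 {(0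 : ℝ)}ᶜ) (nhds (D N))) ∧ Filter.Tendsto D Filter.atTop (nhds k)

/-- item stmt-AtomisticToContinuum-4773 · support · rank 9 · closed · moot by None · by planner
sources: LefevereSchenkel2004, RoyDhar2008, HairerMajda2009, decl Literature.MathematicalPhysics.KineticTheory.HeatConduction.integral_bondCurrent_harmonicNESS_eq_fluxCoeff
[support] ZEROTH ORDER — CONTINUITY OF THE RESPONSE AT THE RLL POINT (fixed N): under weak-NESS
uniqueness, for every steady-state family and response function D of pinnedChain ω₂ lam β γ (all >
0) and every N, D N T → (N−1)·fluxCoeff ω₂ γ N as T → 0⁺ (N = 0, 1: both sides 0). By the conjugacy: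
the response of the chain with couplings (lamT, βT) at temperature 1 tends to the harmonic response
(N−1)c_N (fluxCoeff_eq, integral_bondCurrent_harmonicNESS_eq_fluxCoeff, proved) as the couplings
vanish — stability of the finite-N NESS and of its temperature-derivative under a vanishing quartic
perturbation (uniform-in-coupling Lyapunov/hypocoercive control at fixed N). The base case of
SecularOnset; a Lean warm-up with real content. [difficulty: M] -/
@[route_item "route-AtomisticToContinuum-OnsetOfResistance"]
def HarmonicLimitOfResponse : Prop :=
  ∀ ω₂ lam β γ : ℝ, 0 < ω₂ → 0 < lam → 0 < β → 0 < γ → (∀ (N : ℕ) (T_L T_R : ℝ), 0 < T_L → 0 < T_R → ∀ μ ν : MeasureTheory.Measure (Literature.MathematicalPhysics.KineticTheory.HeatConduction.PhaseSpace N), (Literature.MathematicalPhysics.KineticTheory.HeatConduction.pinnedChain ω₂ lam β γ).IsSteadyState N T_L T_R μ → (Literature.MathematicalPhysics.KineticTheory.HeatConduction.pinnedChain ω₂ lam β γ).IsSteadyState N T_L T_R ν → μ = ν) → ∀ μ : (N : ℕ) → ℝ → ℝ → MeasureTheory.Measure (Literature.MathematicalPhysics.KineticTheory.HeatConduction.PhaseSpace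 N), (∀ (N : ℕ) (T_L T_R : ℝ), 0 < T_L → 0 < T_R → (Literature.MathematicalPhysics.KineticTheory.HeatConduction.pinnedChain ω₂ lam β γ).IsSteadyState N T_L T_R (μ N T_L T_R)) → ∀ D : ℕ → ℝ → ℝ, (∀ T : ℝ, 0 < T → ∀ N : ℕ, Filter.Tendsto (fun δ : ℝ => (Literature.MathematicalPhysics.KineticTheory.HeatConduction.pinnedChain ω₂ lam β γ).totalCurrent (μ N (T + δ / 2) (T - δ / 2)) / δ) (nhdsWithin 0 {(0 : ℝ)}ᶜ) (nhds (D N T))) → ∀ N : ℕ, Filter.Tendsto (fun T : ℝ => D N T) (nhdsWithin 0 (Set.Ioi 0)) (nhds (((N - 1 : ℕ) : ℝ) * Literature.MathematicalPhysics.KineticTheory.HeatConduction.fluxCoeff ω₂ γ N))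

/-- item stmt-AtomisticToContinuum-4774 · support · rank 9 · closed · moot by None · by planner
sources: LefevereSchenkel2004, doi:10.1103/physrevd.101.125002
[support] FIRST ORDER IS STILL BALLISTIC (LefevereSchenkel2004 §6.1 made a theorem in BLR's
linear-response normalisation, with the FPU-β bond quartic included): under weak-NESS uniqueness,
for every steady-state family and response function D there are d₁ : ℕ → ℝ and c₁ with (D N T −
(N−1)·fluxCoeff ω₂ γ N)/T → d₁(N) as T → 0⁺ for every N ≥ 2, and d₁(N)/N → c₁ (a Hartree
renormalisation of the ballistic coefficient: same N-scaling as order zero — "the first-order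
correction of the heat current does not depend on the size of the system"). The first rung of
SecularOnset. [difficulty: L] -/
@[route_item "route-AtomisticToContinuum-OnsetOfResistance"]
def FirstOrderBallistic : Prop :=
  ∀ ω₂ lam β γ : ℝ, 0 < ω₂ → 0 < lam → 0 < β → 0 < γ → (∀ (N : ℕ) (T_L T_R : ℝ), 0 < T_L → 0 < T_R → ∀ μ ν : MeasureTheory.Measure (Literature.MathematicalPhysics.KineticTheory.HeatConduction.PhaseSpace N), (Literature.MathematicalPhysics.KineticTheory.HeatConduction.pinnedChain ω₂ lam β γ).IsSteadyState N T_L T_R μ → (Literature.MathematicalPhysics.KineticTheory.HeatConduction.pinnedChain ω₂ lam β γ).IsSteadyState N T_L T_R ν → μ = ν) → ∀ μ : (N : ℕ) → ℝ → ℝ → MeasureTheory.Measure (Literature.MathematicalPhysics.KineticTheory.HeatConduction.PhaseSpace N), (∀ (N : ℕ) (T_L T_R : ℝ), 0 < T_L → 0 < T_R → (Literature.MathematicalPhysics.KineticTheory.HeatConduction.pinnedChain ω₂ lam β γ).IsSteadyState N T_L T_R (μ N T_L T_R)) → ∀ D : ℕ → ℝ → ℝ, (∀ T : ℝ, 0 <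 T → ∀ N : ℕ, Filter.Tendsto (fun δ : ℝ => (Literature.MathematicalPhysics.KineticTheory.HeatConduction.pinnedChain ω₂ lam β γ).totalCurrent (μ N (T + δ / 2) (T - δ / 2)) / δ) (nhdsWithin 0 {(0 : ℝ)}ᶜ) (nhds (D N T))) → ∃ d₁ : ℕ → ℝ, ∃ c₁ : ℝ, (∀ N : ℕ, 2 ≤ N → Filter.Tendsto (fun T : ℝ => (D N T - ((N - 1 : ℕ) : ℝ) * Literature.MathematicalPhysics.KineticTheory.HeatConduction.fluxCoeff ω₂ γ N) / T) (nhdsWithin 0 (Set.Ioi 0)) (nhds (d₁ N))) ∧ Filter.Tendsto (fun N : ℕ => d₁ N / (N : ℝ)) Filter.atTop (nhds c₁)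

-- item stmt-AtomisticToContinuum-5064 · support · rank 9 · closed · moot by None · by planner — informal only, no Lean statement yet:
--   [support] KINETIC MATCHING (card Claim 2, CORRECTED by the planner's slab first-collision
--   computation; informal until the linearised phonon-Boltzmann operator C_lin of pinnedChain is a
--   Literature object — definition request LinearizedPhononBoltzmannOperator). (a) The secular
--   coefficient s of SecularOnset equals ¼⟨φ_γ, (−C_lin) φ_γ⟩ in the equal-temperature (T = 1 after
--   conjugacy) weighted L²(𝕋, dk), where φ_γ(k) = θ_γ(k)·sign ω′(k) is the contact-filtered
--   Rieder–Lebowitz–Lieb occupation profile of the ballistic steady state, θ_γ = (1 − R_γ)/(1 + R_γ)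
--   with R_γ(k) the reflection coefficient of a

/-- item stmt-AtomisticToContinuum-4775 · assembly · rank 1 · closed · moot by None · by planner
sources: BonettoLebowitzReyBellet2000, decl Literature.HeatConduction.fouriersLaw_of_steadyState_and_linearResponse, decl Literature.MathematicalPhysics.KineticTheory.HeatConduction.pinnedChain_exists_isSteadyState
[assembly] SecularOnset → KineticWindowResistance → WindowToLowTFourier → HighTFourier →
BridgeClosure → NessUnique → FouriersLaw. -/
@[route_item "route-AtomisticToContinuum-OnsetOfResistance"]
def Assembly : Prop :=
  SecularOnset → KineticWindowResistance → WindowToLowTFourier → HighTFourier → BridgeClosure → NessUnique → Literature.MathematicalPhysics.KineticTheory.HeatConduction.FouriersLaw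

end Summit.AtomisticToContinuum.FouriersLaw.Theses.OnsetOfResistance
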